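/-
Copyright: public-domain mathematics; typed transcription for the H21 Literature library (cell lit-balaban,
reader/typer seat r02 gen 5 = literature-prover-lit-balaban-r02-g5-0).

statement-level skeleton of published theorems with citation tags; proofs where landed; nothing here is a claim about the Yang–Mills mass gap

# Bałaban, *Propagators and renormalization transformations for lattice gauge theories. I*,
# Commun. Math. Phys. **95** (1984) 17–40 — the CUBE GEOMETRY of the (1.132) pieces on the product torus:
# `|y″ − w| − 2 ≤ |x − x′|` for `x ∈ Δ(y″)`, `x′ ∈ Δ̃(w)` (`B5Transfer132.PieceFacts132.dist_ge`, `c₀ = 2`)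

[cite: Balaban1984PropagatorsI]  T. Bałaban, Commun. Math. Phys. 95 (1984) 17–40.  p. 39 (1.132); p. 35 (the cubes Δ(y), Δ̃(y) of the
unit lattice T₁^{(k)}); p. 38 (1.126) (|x − x′| in e^{−δ′₀|x−x′|}).

WHAT THIS MODULE ADDS (SKELETON row B5.Prop1.2 census (vii), (1.132) half): on the product tori of record (`Tor (fine n M)` fine,
`Tor M` unit; `cube1`, `cubeT`, `distU`, `distSite` of `B5Prop12FieldsLattice`):
* `distSite_le_of_forall_crep` (a coordinatewise bound on the centred representatives bounds `|y − w|`),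
* `abs_crep_uc_sub_of_mem_cube1` (`x ∈ Δ(y″)` ⇒ `|x_μ/n − y″_μ|_{mod M_μ} ≤ 1`),
* **`distSite_sub_two_le_distU`**: `x ∈ Δ(y″)`, `x′ ∈ Δ̃(w)` ⇒ `distSite y″ w − 2 ≤ distU x x′` — the field `dist_ge` of
  `PieceFacts132` for the kernel carrier "fine sites ↦ unit cubes" with `c₀ = 2`.

HONEST SCOPE.  Elementary torus geometry; nothing analytic.
-/
import Mathlib
import Literature.MathematicalPhysics.QuantumFieldTheory.Balaban1983to89.B5CoverP12Lattice

open scoped BigOperators Real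
open Finset

namespace Literature.MathematicalPhysics.QuantumFieldTheory.Balaban1983to89.B5Carrier132CubeGeom

open Literature.MathematicalPhysics.QuantumFieldTheory.Balaban1983to89
open Literature.MathematicalPhysics.QuantumFieldTheory.Balaban1983to89.B5Prop11Plancherel (Tor fine)
open Literature.MathematicalPhysics.QuantumFieldTheory.Balaban1983to89.B5Prop12FieldsLattice (cube1 cubeT distU distSite distU_nonneg)
open Literature.MathematicalPhysics.QuantumFieldTheory.Balaban1983to89.B5CoverP12Lattice (uc abs_crep_add_le abs_crep_le_abs
  abs_crep_uc_sub_le_distU mem_cubeT_iff_crep)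
open Literature.MathematicalPhysics.QuantumFieldTheory.Balaban1983to89.B4TorusKernel.MultiPeriod (circAbs)
open Literature.MathematicalPhysics.QuantumFieldTheory.Balaban1983to89.B5Partition118Printed (crep natMul_abs_crep_eq_circAbs)
open Literature.MathematicalPhysics.QuantumFieldTheory.Balaban1983to89.B5Ineq110P12Lattice (natAbs_valMinAbs_intCast_sub)
open Literature.MathematicalPhysics.QuantumFieldTheory.Balaban1983to89.B6Cov2156Torus (one_le_M)

noncomputable section

variable {d : ℕ} (M : Fin d → ℕ) [hM : ∀ μ, NeZero (M μ)] (n : ℕ) [NeZero n]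

/-! ## §1 The unit-lattice distance coordinatewise -/

omit hM in
/-- one coordinate of `|y − w|` is the centred representative of `y_μ − w_μ`: `|(y_μ − w_μ).valMinAbs| = |crep_{M_μ}(y_μ − w_μ)|`.
[cite: Balaban1984PropagatorsI, p.35 (T₁^{(k)})] -/
theorem natAbs_valMinAbs_eq_abs_crep [hM : ∀ μ, NeZero (M μ)] (y w : Tor M) (μ : Fin d) :
    (((y μ - w μ).valMinAbs.natAbs : ℕ) : ℝ) = |crep (M μ) (((y μ).val : ℝ) - ((w μ).val : ℝ))| := by
  have h1 : (((((((y μ).val : ℕ) : ℤ) : ZMod (M μ)) - ((((w μ).val : ℕ) : ℤ) : ZMod (M μ))).valMinAbs.natAbs : ℕ) : ℤ)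
      = circAbs (M μ) ((((y μ).val : ℕ) : ℤ) - (((w μ).val : ℕ) : ℤ)) := natAbs_valMinAbs_intCast_sub _ _
  rw [show ((((y μ).val : ℕ) : ℤ) : ZMod (M μ)) = y μ by rw [Int.cast_natCast, ZMod.natCast_zmod_val],
    show ((((w μ).val : ℕ) : ℤ) : ZMod (M μ)) = w μ by rw [Int.cast_natCast, ZMod.natCast_zmod_val]] at h1
  have h2 := natMul_abs_crep_eq_circAbs (M₀ := 1) (P := M μ) le_rfl (one_le_M M μ) ((((y μ).val : ℕ) : ℤ) - (((w μ).val : ℕ) : ℤ))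
  rw [Nat.cast_one, one_mul, div_one, one_mul] at h2
  have h3 : (((y μ - w μ).valMinAbs.natAbs : ℕ) : ℝ) = ((circAbs (M μ) ((((y μ).val : ℕ) : ℤ) - (((w μ).val : ℕ) : ℤ)) : ℤ) : ℝ) := by
    rw [← h1, Int.cast_natCast]
  rw [h3, ← h2]
  push_cast
  ring_nf

omit hM in
/-- **a coordinatewise bound on the centred representatives bounds `|y − w|`.** [cite: Balaban1984PropagatorsI, p.35 (T₁^{(k)})] -/
theorem distSite_le_of_forall_crep [hM : ∀ μ, NeZero (M μ)] (y w : Tor M) {r : ℝ} (hr : 0 ≤ r)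
    (h : ∀ μ, |crep (M μ) (((y μ).val : ℝ) - ((w μ).val : ℝ))| ≤ r) : distSite M y w ≤ r := by
  unfold distSite
  have hsup : (Finset.univ.sup fun μ => ((y μ - w μ).valMinAbs).natAbs) ≤ ⌊r⌋₊ := by
    refine Finset.sup_le fun μ _ => ?_
    rw [Nat.le_floor_iff hr, natAbs_valMinAbs_eq_abs_crep M y w μ]
    exact h μ
  calc ((Finset.univ.sup fun μ => ((y μ - w μ).valMinAbs).natAbs : ℕ) : ℝ) ≤ (⌊r⌋₊ : ℝ) := by exact_mod_cast hsup
    _ ≤ r := Nat.floor_le hr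

/-! ## §2 `x ∈ Δ(y″)`, `x′ ∈ Δ̃(w)` and the distance of the labels -/

omit hM in
/-- `x ∈ Δ(y″)` (the unit cube labelled `y″`: `⌊x_μ/n⌋ = y″_μ`) ⇒ `0 ≤ x_μ/n − y″_μ < 1`, hence `|crep(x_μ/n − y″_μ)| ≤ 1`.
[cite: Balaban1984PropagatorsI, p.35 (Δ(y) ⊂ Δ̃(y))] -/
theorem abs_crep_uc_sub_of_mem_cube1 [hM : ∀ μ, NeZero (M μ)] (hn : 1 ≤ n) {x : Tor (fine n M)} {y : Tor M} (hx : x ∈ cube1 n M y)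
    (μ : Fin d) : |crep (M μ) (uc M n x μ - ((y μ).val : ℝ))| ≤ 1 := by
  have hM0 : (0 : ℝ) < M μ := by exact_mod_cast one_le_M M μ
  have hn0 : (0 : ℝ) < n := by exact_mod_cast hn
  have hq : (x μ).val / n = (y μ).val := ((Finset.mem_filter.mp hx).2) μ
  refine (abs_crep_le_abs hM0 _).trans ?_
  have h1 : ((y μ).val : ℝ) ≤ uc M n x μ := by
    unfold uc
    rw [le_div_iff₀ hn0, ← hq]
    exact_mod_cast Nat.div_mul_le_self _ _
  have h2 : uc M n x μ < ((y μ).val : ℝ) + 1 := by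
    unfold uc
    rw [div_lt_iff₀ hn0, ← hq]
    have := Nat.lt_div_mul_add (a := (x μ).val) (b := n) (by omega)
    have h' : (((x μ).val : ℕ) : ℝ) < (((x μ).val / n * n + n : ℕ) : ℝ) := by exact_mod_cast this
    push_cast at h'
    linarith
  rw [abs_le]
  constructor <;> linarith

omit hM in
/-- **`dist_ge` of `PieceFacts132` on the product torus, `c₀ = 2`**: for `x ∈ Δ(y″)` and `x′ ∈ Δ̃(w)`,
`|y″ − w| − 2 ≤ |x − x′|`. [cite: Balaban1984PropagatorsI, (1.132) p.39 with (1.126) p.38 and p.35 (the cubes)] -/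
theorem distSite_sub_two_le_distU [hM : ∀ μ, NeZero (M μ)] (hn : 1 ≤ n) {x x' : Tor (fine n M)} {y'' w : Tor M}
    (hx : x ∈ cube1 n M y'') (hx' : x' ∈ cubeT n M w) : distSite M y'' w - 2 ≤ distU n M x x' := by
  rw [sub_le_iff_le_add]
  refine distSite_le_of_forall_crep M y'' w (by linarith [distU_nonneg (n := n) (M := M) x x']) fun μ => ?_
  have hM0 : (0 : ℝ) < M μ := by exact_mod_cast one_le_M M μ
  have h1 : |crep (M μ) (((y'' μ).val : ℝ) - uc M n x μ)| ≤ 1 := by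
    rw [show ((y'' μ).val : ℝ) - uc M n x μ = -(uc M n x μ - ((y'' μ).val : ℝ)) by ring, B5CoverP12Lattice.abs_crep_neg hM0]
    exact abs_crep_uc_sub_of_mem_cube1 M n hn hx μ
  have h2 : |crep (M μ) (uc M n x μ - uc M n x' μ)| ≤ distU n M x x' := abs_crep_uc_sub_le_distU M n hn x x' μ
  have h3 : |crep (M μ) (uc M n x' μ - ((w μ).val : ℝ))| ≤ 1 := (mem_cubeT_iff_crep M n hn x' w).mp hx' μ
  have e : ((y'' μ).val : ℝ) - ((w μ).val : ℝ)
      = ((((y'' μ).val : ℝ) - uc M n x μ) + (uc M n x μ - uc M n x' μ)) + (uc M n x' μ - ((w μ).val : ℝ)) := by ring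
  rw [e]
  refine (abs_crep_add_le hM0 _ _).trans ?_
  have h12 := abs_crep_add_le hM0 (((y'' μ).val : ℝ) - uc M n x μ) (uc M n x μ - uc M n x' μ)
  linarith

end

end Literature.MathematicalPhysics.QuantumFieldTheory.Balaban1983to89.B5Carrier132CubeGeom
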